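import Summits.ValiantsHypothesis.ValiantsHypothesis.Theses.AnyonJets
import Summits.ValiantsHypothesis.ValiantsHypothesis.Theorems.AnyonJetsConstantFreeJetGrowthDefs
import Summits.ValiantsHypothesis.ValiantsHypothesis.Theorems.AnyonJetsJetConstantElimMultiplierRemovalCalibration
import Summits.ValiantsHypothesis.ValiantsHypothesis.Theorems.AnyonJetsJetConstantElimSignSimulation
import Summits.ValiantsHypothesis.ValiantsHypothesis.Theorems.AnyonJetsJetConstantElimAlgebraicDescent
import Summits.ValiantsHypothesis.ValiantsHypothesis.Theorems.LacunarySymmetroidMatrixDescartesStubShadowArith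
import Literature.Computability.AlgebraicComplexity.ConstantFreeNumerals
import Mathlib.FieldTheory.IsAlgClosed.AlgebraicClosure
import Mathlib.Analysis.Complex.Polynomial.Basic
import HarnessLib

/-!
# AnyonJets — crux `JetConstantElim` (stmt-ValiantsHypothesis-16737), line `birth`:
# calibration of the open stub `stub_integralMultiple` (what it follows from, what it costs)

Route `ValiantsHypothesis/AnyonJets`, crux `JetConstantElim` (`CE`), registered line
`Cruxes/JetConstantElim/Lines/birth.lean` (descent `ℂ → ℚ̄` · integral multiple · sign simulation
· multiplier removal). Its second, load-bearing stub `stub_integralMultiple` (`IM`) says: for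
`k ≤ log₂ n`, ANY fan-in-two circuit `Q` over `ℚ̄ = AlgebraicClosure ℚ` computing the anyonic jet
`J_(n,k) = Σ_σ sgn σ · C(inv σ, k) · Π_i X_(σ i, i)` yields an INTEGER fan-in-two circuit `P`, all of
whose constants and sum coefficients are bounded by `2^t` in absolute value, computing some
positive integer multiple `M · J_(n,k)`, with `size P + t + 2 ≤ (size Q + n + 2)^{b₁}`. It is the
"field-of-definition" half of the crux (degree AND height of the constants of near-optimal
circuits of the explicit easy families `J_k`), conjecture-grade (Bürgisser 2000 Ch. 4; Koiran–Perifel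
2011 Rem. 4).

This helper file (no `sorry`, no definitions, no named-fact hypotheses; the growth bookkeeping
`X^c + X ≤ X^(c+2)` is the tree's `StubShadowArith.pow_add_self_le`) records, sorry-free, where
the stub sits — the companion of `AnyonJetsJetConstantElimMultiplierRemovalCalibration.lean` for the
sibling stub `MR`:

* `integralMultiple_of_jetConstantElim` — **`CE → IM`** (the stub is NECESSARY for the crux:
  `L_ℂ(J) ≤ size Q` by base change `ℚ̄ → ℂ`, and a `τ`-optimal sign-constant circuit is an integer
  circuit of height `2^0`, multiplier `M = 1`; exponent `b₁ = b + 2`).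
* `jetConstantElim_iff_integralMultiple_and_multiplierRemoval` — **`CE ↔ IM ∧ MR`**: together
  with the two stubs of the line already PROVED in the tree (`stub_algebraicDescent`,
  `stub_signSimulation`) the two open stubs are JOINTLY EQUIVALENT to the crux (the line cuts the
  crux without slack and without surplus).
* `integralMultiple_fixedOrder` — every FIXED-order truncation (`k ≤ k₀`) of `IM` follows from the
  route's `JetFlatness` (PROVED in the tree, `Theorems.AnyonJets.jetFlatness_proof`; hypothesis
  here only to stay out of that module's import cone), ignoring `Q`: the content of `IM` is only
  the uniformity in `k ≤ log₂ n`.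
* `integralMultiple_of_uniformIntegralJets`, `cheapMultiples_of_uniformIntegralJets`,
  `not_constantFreeJetGrowth_of_uniformIntegralJets_of_multiplierRemoval` — THE `Q`-FREE ROAD IS
  CLOSED: a proof of `IM` that does not read the given `ℚ̄`-circuit `Q` is a uniform polynomial
  bound on bounded-height integer circuits for multiples of the jets; by `stub_signSimulation` that
  is "uniformly cheap multiples", which under the sibling stub `MR` refutes the sibling crux
  `ConstantFreeJetGrowth` (tree: `not_multiplierRemoval_of_cheapMultiples_of_cfGrowth`). So any
  proof of `IM` the route can use must read the ARBITRARY near-optimal `ℚ̄`-circuit it is given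
  (field of definition of polynomial degree, constants of polynomial height): constant
  elimination proper, for which print records no technique.

Honest framing: calibration lemmas for an OPEN, conjecture-grade stub; neither `IM` nor `¬IM` is
proved; the crux `JetConstantElim` stays open; VP ≠ VNP is NOT proved here.

References: Bürgisser–Clausen–Shokrollahi, *Algebraic Complexity Theory* (1997), §4.1, §4.3,
Thm. (9.15); Koiran–Perifel, *Interpolation in Valiant's theory* (2011), Rem. 4; Bürgisser,
*Completeness and Reduction in Algebraic Complexity Theory* (2000), §4.1.
-/

noncomputable section

-- single-conjunct layout: Sub = Summit, duplicated namespace component intended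
set_option linter.dupNamespace false

namespace Summit.ValiantsHypothesis.ValiantsHypothesis.Theorems.AnyonJets.JetConstantElim

open MvPolynomial Literature.Computability.AlgebraicComplexity
open Literature.Computability.AlgebraicComplexity.ArithCircuit
open Summit.ValiantsHypothesis.ValiantsHypothesis.Theses.AnyonJets
open Summit.ValiantsHypothesis.ValiantsHypothesis.Theorems.AnyonJets.ConstantFreeJetGrowth (jet)

/-! ### The stub, read through the tree's `jet` (`Iff.rfl`) -/

/-- The statement of `stub_integralMultiple` (alias `IntegralMultiple` of the skeleton) with the
route's `let J` replaced by the tree's `jet` (rfl). [folklore] -/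
theorem integralMultiple_iff_jet :
    (let J := fun (n k : ℕ) => (∑ σ : Equiv.Perm (Fin n), MvPolynomial.C (((Equiv.Perm.sign σ : ℤˣ) : ℤ) * (((Finset.univ.filter (fun p : Fin n × Fin n => p.1 < p.2 ∧ σ p.2 < σ p.1)).card.choose k : ℕ) : ℤ)) * ∏ i : Fin n, MvPolynomial.X (σ i, i) : MvPolynomial (Fin n × Fin n) ℤ);
    ∃ b₁ : ℕ, ∀ n k : ℕ, k ≤ Nat.log 2 n →
      ∀ Q : Literature.Computability.AlgebraicComplexity.ArithCircuit (AlgebraicClosure ℚ) (Fin n × Fin n),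
        Q.IsFanInTwo →
        Q.Computes (MvPolynomial.map (Int.castRingHom (AlgebraicClosure ℚ)) (J n k)) →
        ∃ (P : Literature.Computability.AlgebraicComplexity.ArithCircuit ℤ (Fin n × Fin n)) (t M : ℕ),
          1 ≤ M ∧ P.IsFanInTwo ∧ P.Computes ((M : ℤ) • J n k) ∧
          ((∀ g ∈ P.gates, ∀ u ∈ g.args, ∀ c : ℤ, u = .const c → c.natAbs ≤ 2 ^ t) ∧
            (∀ args : List (ℤ × Literature.Computability.AlgebraicComplexity.ArithCircuit.Operand ℤ (Fin n × Fin n)),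
              Literature.Computability.AlgebraicComplexity.ArithCircuit.Gate.sum args ∈ P.gates →
                ∀ a ∈ args, a.1.natAbs ≤ 2 ^ t) ∧
            (∀ c : ℤ, P.output = .const c → c.natAbs ≤ 2 ^ t)) ∧
          P.size + t + 2 ≤ (Q.size + n + 2) ^ b₁) ↔
    ∃ b₁ : ℕ, ∀ n k : ℕ, k ≤ Nat.log 2 n →
      ∀ Q : ArithCircuit (AlgebraicClosure ℚ) (Fin n × Fin n), Q.IsFanInTwo →
        Q.Computes (MvPolynomial.map (Int.castRingHom (AlgebraicClosure ℚ)) (jet n k)) →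
        ∃ (P : ArithCircuit ℤ (Fin n × Fin n)) (t M : ℕ),
          1 ≤ M ∧ P.IsFanInTwo ∧ P.Computes ((M : ℤ) • jet n k) ∧
          ((∀ g ∈ P.gates, ∀ u ∈ g.args, ∀ c : ℤ, u = .const c → c.natAbs ≤ 2 ^ t) ∧
            (∀ args : List (ℤ × Operand ℤ (Fin n × Fin n)), Gate.sum args ∈ P.gates →
              ∀ a ∈ args, a.1.natAbs ≤ 2 ^ t) ∧
            (∀ c : ℤ, P.output = .const c → c.natAbs ≤ 2 ^ t)) ∧
          P.size + t + 2 ≤ (Q.size + n + 2) ^ b₁ :=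
  Iff.rfl

/-! ### Two bookkeeping facts: sign constants have height `2^0`; `L_ℂ ≤ size` of a `ℚ̄`-circuit -/

/-- A sign constant (`0`, `1` or `−1`) has absolute value at most `1 = 2^0`. [folklore] -/
theorem natAbs_le_one_of_isSignConstant {c : ℤ} (hc : IsSignConstant c) : c.natAbs ≤ 2 ^ 0 := by
  rcases hc with h | h | h
  · subst h; simp
  · subst h; simp
  · obtain rfl : c = -1 := by omega
    simp

/-- **A constant-free circuit is an integer circuit of height `2^0`**: the line's height predicate
(all constant operands, all sum coefficients and a constant output bounded by `2^t` in absolute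
value) holds with `t = 0` for every circuit with sign constants. [cite: Burgisser2000, §1.4] -/
theorem heightBound_zero_of_hasSignConstants {σ : Type*} {P : ArithCircuit ℤ σ}
    (hs : P.HasSignConstants) :
    (∀ g ∈ P.gates, ∀ u ∈ g.args, ∀ c : ℤ, u = .const c → c.natAbs ≤ 2 ^ 0) ∧
      (∀ args : List (ℤ × Operand ℤ σ), Gate.sum args ∈ P.gates →
        ∀ a ∈ args, a.1.natAbs ≤ 2 ^ 0) ∧
      (∀ c : ℤ, P.output = .const c → c.natAbs ≤ 2 ^ 0) := by
  obtain ⟨hg, ho⟩ := hs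
  refine ⟨?_, ?_, ?_⟩
  · intro g hgP u hu c huc
    subst huc
    have hgs := hg g hgP
    cases g with
    | sum args =>
      simp only [Gate.args, List.mem_map] at hu
      obtain ⟨a, ha, hau⟩ := hu
      have h2 := (hgs a ha).2
      rw [hau] at h2
      exact natAbs_le_one_of_isSignConstant h2
    | prod args =>
      exact natAbs_le_one_of_isSignConstant (hgs _ hu)
  · intro args hargs a ha
    exact natAbs_le_one_of_isSignConstant ((hg _ hargs) a ha).1
  · intro c hc
    rw [hc] at ho
    exact natAbs_le_one_of_isSignConstant ho

/-- **`L_ℂ(f) ≤ size Q` for a fan-in-two `ℚ̄`-circuit `Q` computing the integer polynomial `f`**: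
base change along an embedding `ℚ̄ → ℂ` (a choice, `IsAlgClosed.lift`) keeps size and fan-in and
maps the computed polynomial. [cite: Burgisser2000, §4.1] -/
theorem complexity_complex_le_size_of_computes_algClosure {σ : Type*} (f : MvPolynomial σ ℤ)
    {Q : ArithCircuit (AlgebraicClosure ℚ) σ} (h2 : Q.IsFanInTwo)
    (hc : Q.Computes (MvPolynomial.map (Int.castRingHom (AlgebraicClosure ℚ)) f)) :
    complexity (MvPolynomial.map (Int.castRingHom ℂ) f) ≤ Q.size := by
  haveI : Algebra.IsAlgebraic ℚ (AlgebraicClosure ℚ) := AlgebraicClosure.isAlgebraic ℚ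
  let ι : AlgebraicClosure ℚ →ₐ[ℚ] ℂ :=
    IsAlgClosed.lift (R := ℚ) (S := AlgebraicClosure ℚ) (M := ℂ)
  have hmap : MvPolynomial.map (ι : AlgebraicClosure ℚ →+* ℂ)
      (MvPolynomial.map (Int.castRingHom (AlgebraicClosure ℚ)) f) =
      MvPolynomial.map (Int.castRingHom ℂ) f := by
    rw [MvPolynomial.map_map]
    exact congrArg (fun φ : ℤ →+* ℂ => MvPolynomial.map φ f) (RingHom.ext_int _ _)
  have hQ := hc.map (ι : AlgebraicClosure ℚ →+* ℂ)
  rw [hmap] at hQ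
  simpa [size_map] using complexity_le_size (h2.map _) hQ

/-! ### `IM` is necessary for the crux: `CE → IM` -/

/-- **`CE → IM` in `jet` form** (exponent `b₁ = b + 2`): from `τ(J) ≤ (L_ℂ(J) + n + 2)^b` and
`L_ℂ(J) ≤ size Q`, a `τ`-optimal sign-constant circuit `P` computes `1 · J` with height `2^0` and
`size P + 0 + 2 ≤ X^b + X ≤ X^{b+2}`, `X = size Q + n + 2`. [folklore] -/
theorem integralMultiple_jet_of_jetConstantElim (hCE : JetConstantElim) :
    ∃ b₁ : ℕ, ∀ n k : ℕ, k ≤ Nat.log 2 n →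
      ∀ Q : ArithCircuit (AlgebraicClosure ℚ) (Fin n × Fin n), Q.IsFanInTwo →
        Q.Computes (MvPolynomial.map (Int.castRingHom (AlgebraicClosure ℚ)) (jet n k)) →
        ∃ (P : ArithCircuit ℤ (Fin n × Fin n)) (t M : ℕ),
          1 ≤ M ∧ P.IsFanInTwo ∧ P.Computes ((M : ℤ) • jet n k) ∧
          ((∀ g ∈ P.gates, ∀ u ∈ g.args, ∀ c : ℤ, u = .const c → c.natAbs ≤ 2 ^ t) ∧
            (∀ args : List (ℤ × Operand ℤ (Fin n × Fin n)), Gate.sum args ∈ P.gates →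
              ∀ a ∈ args, a.1.natAbs ≤ 2 ^ t) ∧
            (∀ c : ℤ, P.output = .const c → c.natAbs ≤ 2 ^ t)) ∧
          P.size + t + 2 ≤ (Q.size + n + 2) ^ b₁ := by
  rw [jetConstantElim_iff_jet] at hCE
  obtain ⟨b, hb⟩ := hCE
  refine ⟨b + 2, fun n k hk Q hQ2 hQc => ?_⟩
  obtain ⟨P, hP2, hPs, hPc, hPsize⟩ := exists_computes_size_eq_constantFreeComplexity (jet n k)
  refine ⟨P, 0, 1, le_rfl, hP2, ?_, heightBound_zero_of_hasSignConstants hPs, ?_⟩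
  · simpa using hPc
  · have hL := complexity_complex_le_size_of_computes_algClosure (jet n k) hQ2 hQc
    set X := Q.size + n + 2 with hX
    have hX2 : 2 ≤ X := by omega
    calc P.size + 0 + 2
        = constantFreeComplexity (jet n k) + 2 := by rw [hPsize]
      _ ≤ (complexity (MvPolynomial.map (Int.castRingHom ℂ) (jet n k)) + n + 2) ^ b + 2 :=
          Nat.add_le_add_right (hb n k hk) 2
      _ ≤ X ^ b + X := add_le_add (Nat.pow_le_pow_left (by omega) _) hX2
      _ ≤ X ^ (b + 2) := LacunarySymmetroidMatrixDescartes.StubShadowArith.pow_add_self_le X b hX2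


/-- **`CE → IM`, signature of `stub_integralMultiple` verbatim**: the registered stub is implied by
the crux, so a refutation of the stub refutes the crux. [folklore] -/
theorem integralMultiple_of_jetConstantElim (hCE : JetConstantElim) :
    let J := fun (n k : ℕ) => (∑ σ : Equiv.Perm (Fin n), MvPolynomial.C (((Equiv.Perm.sign σ : ℤˣ) : ℤ) * (((Finset.univ.filter (fun p : Fin n × Fin n => p.1 < p.2 ∧ σ p.2 < σ p.1)).card.choose k : ℕ) : ℤ)) * ∏ i : Fin n, MvPolynomial.X (σ i, i) : MvPolynomial (Fin n × Fin n) ℤ);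
    ∃ b₁ : ℕ, ∀ n k : ℕ, k ≤ Nat.log 2 n →
      ∀ Q : Literature.Computability.AlgebraicComplexity.ArithCircuit (AlgebraicClosure ℚ) (Fin n × Fin n),
        Q.IsFanInTwo →
        Q.Computes (MvPolynomial.map (Int.castRingHom (AlgebraicClosure ℚ)) (J n k)) →
        ∃ (P : Literature.Computability.AlgebraicComplexity.ArithCircuit ℤ (Fin n × Fin n)) (t M : ℕ),
          1 ≤ M ∧ P.IsFanInTwo ∧ P.Computes ((M : ℤ) • J n k) ∧
          ((∀ g ∈ P.gates, ∀ u ∈ g.args, ∀ c : ℤ, u = .const c → c.natAbs ≤ 2 ^ t) ∧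
            (∀ args : List (ℤ × Literature.Computability.AlgebraicComplexity.ArithCircuit.Operand ℤ (Fin n × Fin n)),
              Literature.Computability.AlgebraicComplexity.ArithCircuit.Gate.sum args ∈ P.gates →
                ∀ a ∈ args, a.1.natAbs ≤ 2 ^ t) ∧
            (∀ c : ℤ, P.output = .const c → c.natAbs ≤ 2 ^ t)) ∧
          P.size + t + 2 ≤ (Q.size + n + 2) ^ b₁ :=
  integralMultiple_iff_jet.mpr (integralMultiple_jet_of_jetConstantElim hCE)

/-! ### The line cuts the crux exactly: `CE ↔ IM ∧ MR` -/

/-- **`IM ∧ MR → CE`** with the two PROVED stubs of the line wired in (`stub_algebraicDescent`,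
`stub_signSimulation`, both landed in `Theorems/`): the composition of the birth skeleton, exponent
`b = (b₁ b₂ + 2) b₃` — descent gives a `ℚ̄`-circuit of size `≤ L = L_ℂ(J)`, `IM` an integer circuit
with `size + t + 2 ≤ X^{b₁}`, `X = size + n + 2 ≤ L + n + 2`, for some `M·J`, sign simulation
`τ(M·J) ≤ X^{b₁ b₂}`, and `MR` `τ(J) ≤ (X^{b₁ b₂} + n + 2)^{b₃} ≤ X^{(b₁ b₂ + 2) b₃}`.
(Adapted from the registered skeleton `Cruxes/JetConstantElim/Lines/birth.lean`, `assemble` /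
`JetConstantElim_of`.) [folklore] -/
theorem jetConstantElim_of_integralMultiple_of_multiplierRemoval
    (hI : ∃ b₁ : ℕ, ∀ n k : ℕ, k ≤ Nat.log 2 n →
      ∀ Q : ArithCircuit (AlgebraicClosure ℚ) (Fin n × Fin n), Q.IsFanInTwo →
        Q.Computes (MvPolynomial.map (Int.castRingHom (AlgebraicClosure ℚ)) (jet n k)) →
        ∃ (P : ArithCircuit ℤ (Fin n × Fin n)) (t M : ℕ),
          1 ≤ M ∧ P.IsFanInTwo ∧ P.Computes ((M : ℤ) • jet n k) ∧
          ((∀ g ∈ P.gates, ∀ u ∈ g.args, ∀ c : ℤ, u = .const c → c.natAbs ≤ 2 ^ t) ∧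
            (∀ args : List (ℤ × Operand ℤ (Fin n × Fin n)), Gate.sum args ∈ P.gates →
              ∀ a ∈ args, a.1.natAbs ≤ 2 ^ t) ∧
            (∀ c : ℤ, P.output = .const c → c.natAbs ≤ 2 ^ t)) ∧
          P.size + t + 2 ≤ (Q.size + n + 2) ^ b₁)
    (hR : ∃ b₃ : ℕ, ∀ n k M : ℕ, k ≤ Nat.log 2 n → 1 ≤ M →
      constantFreeComplexity (jet n k) ≤ (constantFreeComplexity ((M : ℤ) • jet n k) + n + 2) ^ b₃) :
    JetConstantElim := by
  rw [jetConstantElim_iff_jet]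
  obtain ⟨b₁, hb₁⟩ := hI
  obtain ⟨b₂, hb₂⟩ := stub_signSimulation
  obtain ⟨b₃, hb₃⟩ := hR
  refine ⟨(b₁ * b₂ + 2) * b₃, fun n k hk => ?_⟩
  obtain ⟨Q, hQ2, hQc, hQs⟩ := stub_algebraicDescent (Fin n × Fin n) (jet n k)
  obtain ⟨P, t, M, hM, hP2, hPc, hPb, hPs⟩ := hb₁ n k hk Q hQ2 hQc
  have hτM : constantFreeComplexity ((M : ℤ) • jet n k) ≤ (P.size + t + 2) ^ b₂ :=
    hb₂ (Fin n × Fin n) _ P t hP2 hPc hPb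
  have hRk := hb₃ n k M hk hM
  set L := complexity (MvPolynomial.map (Int.castRingHom ℂ) (jet n k)) with hL
  set X := Q.size + n + 2 with hX
  have hX2 : 2 ≤ X := by omega
  have hXL : X ≤ L + n + 2 := by omega
  have hPX : (P.size + t + 2) ^ b₂ ≤ X ^ (b₁ * b₂) := by
    calc (P.size + t + 2) ^ b₂ ≤ (X ^ b₁) ^ b₂ := Nat.pow_le_pow_left hPs _
      _ = X ^ (b₁ * b₂) := by rw [← pow_mul]
  have hmid : constantFreeComplexity ((M : ℤ) • jet n k) + n + 2 ≤ X ^ (b₁ * b₂ + 2) := by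
    have h1 : constantFreeComplexity ((M : ℤ) • jet n k) + n + 2 ≤ X ^ (b₁ * b₂) + X := by omega
    exact le_trans h1 (LacunarySymmetroidMatrixDescartes.StubShadowArith.pow_add_self_le X (b₁ * b₂) hX2)
  calc constantFreeComplexity (jet n k)
      ≤ (constantFreeComplexity ((M : ℤ) • jet n k) + n + 2) ^ b₃ := hRk
    _ ≤ (X ^ (b₁ * b₂ + 2)) ^ b₃ := Nat.pow_le_pow_left hmid _
    _ ≤ ((L + n + 2) ^ (b₁ * b₂ + 2)) ^ b₃ := Nat.pow_le_pow_left (Nat.pow_le_pow_left hXL _) _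
    _ = (L + n + 2) ^ ((b₁ * b₂ + 2) * b₃) := by rw [← pow_mul]

/-- **`CE ↔ IM ∧ MR`** (signatures of `stub_integralMultiple` and `stub_multiplierRemoval`
verbatim): given the two landed stubs of the line, its two OPEN stubs are jointly EQUIVALENT to the
crux — necessity by `integralMultiple_of_jetConstantElim` and the tree's
`multiplierRemoval_of_jetConstantElim`, sufficiency by the composition. In particular `IM` is, modulo
`MR` and two theorems, the crux itself: the line LOCALISES the difficulty (field of definition vs.
integer division), it does not shrink it. [folklore] -/
theorem jetConstantElim_iff_integralMultiple_and_multiplierRemoval :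
    JetConstantElim ↔
    ((let J := fun (n k : ℕ) => (∑ σ : Equiv.Perm (Fin n), MvPolynomial.C (((Equiv.Perm.sign σ : ℤˣ) : ℤ) * (((Finset.univ.filter (fun p : Fin n × Fin n => p.1 < p.2 ∧ σ p.2 < σ p.1)).card.choose k : ℕ) : ℤ)) * ∏ i : Fin n, MvPolynomial.X (σ i, i) : MvPolynomial (Fin n × Fin n) ℤ);
      ∃ b₁ : ℕ, ∀ n k : ℕ, k ≤ Nat.log 2 n → ∀ Q : Literature.Computability.AlgebraicComplexity.ArithCircuit (AlgebraicClosure ℚ) (Fin n × Fin n), Q.IsFanInTwo → Q.Computes (MvPolynomial.map (Int.castRingHom (AlgebraicClosure ℚ)) (J n k)) →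
        ∃ (P : Literature.Computability.AlgebraicComplexity.ArithCircuit ℤ (Fin n × Fin n)) (t M : ℕ), 1 ≤ M ∧ P.IsFanInTwo ∧ P.Computes ((M : ℤ) • J n k) ∧
          ((∀ g ∈ P.gates, ∀ u ∈ g.args, ∀ c : ℤ, u = .const c → c.natAbs ≤ 2 ^ t) ∧ (∀ args : List (ℤ × Literature.Computability.AlgebraicComplexity.ArithCircuit.Operand ℤ (Fin n × Fin n)), Literature.Computability.AlgebraicComplexity.ArithCircuit.Gate.sum args ∈ P.gates → ∀ a ∈ args, a.1.natAbs ≤ 2 ^ t) ∧ (∀ c : ℤ, P.output = .const c → c.natAbs ≤ 2 ^ t)) ∧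
          P.size + t + 2 ≤ (Q.size + n + 2) ^ b₁) ∧
    (let J := fun (n k : ℕ) => (∑ σ : Equiv.Perm (Fin n), MvPolynomial.C (((Equiv.Perm.sign σ : ℤˣ) : ℤ) * (((Finset.univ.filter (fun p : Fin n × Fin n => p.1 < p.2 ∧ σ p.2 < σ p.1)).card.choose k : ℕ) : ℤ)) * ∏ i : Fin n, MvPolynomial.X (σ i, i) : MvPolynomial (Fin n × Fin n) ℤ);
      ∃ b₃ : ℕ, ∀ n k M : ℕ, k ≤ Nat.log 2 n → 1 ≤ M → Literature.Computability.AlgebraicComplexity.constantFreeComplexity (J n k) ≤ (Literature.Computability.AlgebraicComplexity.constantFreeComplexity ((M : ℤ) • J n k) + n + 2) ^ b₃)) :=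
  ⟨fun hCE => ⟨integralMultiple_of_jetConstantElim hCE, multiplierRemoval_of_jetConstantElim hCE⟩,
    fun h => jetConstantElim_of_integralMultiple_of_multiplierRemoval
      (integralMultiple_iff_jet.mp h.1) (multiplierRemoval_iff_jet.mp h.2)⟩

/-! ### Every fixed-order truncation of `IM` is free (and ignores `Q`) -/

/-- **Fixed order**: for every `k₀` there is `b₁` such that the conclusion of `IM` holds for all
`n`, all `k ≤ k₀` and every `Q` — indeed with `M = 1`, `t = 0` and `P` a `τ`-optimal sign-constant
circuit, from the route's flatness bound `JetFlatness` (`τ(J_(n,k)) ≤ (n+2)^{4k+c₀}·(2k+2)!`,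
PROVED in the tree as `Theorems.AnyonJets.jetFlatness_proof`; a hypothesis here only to keep this
file out of that module's import cone) and `n + 2 ≤ size Q + n + 2`; witness
`b₁ = 4k₀ + c₀ + (2k₀+2)! + 2`. The content of the stub is only the uniformity in `k ≤ log₂ n`.
[folklore] -/
theorem integralMultiple_fixedOrder (hF : JetFlatness) (k₀ : ℕ) :
    ∃ b₁ : ℕ, ∀ n k : ℕ, k ≤ k₀ →
      ∀ Q : ArithCircuit (AlgebraicClosure ℚ) (Fin n × Fin n), Q.IsFanInTwo →
        Q.Computes (MvPolynomial.map (Int.castRingHom (AlgebraicClosure ℚ)) (jet n k)) →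
        ∃ (P : ArithCircuit ℤ (Fin n × Fin n)) (t M : ℕ),
          1 ≤ M ∧ P.IsFanInTwo ∧ P.Computes ((M : ℤ) • jet n k) ∧
          ((∀ g ∈ P.gates, ∀ u ∈ g.args, ∀ c : ℤ, u = .const c → c.natAbs ≤ 2 ^ t) ∧
            (∀ args : List (ℤ × Operand ℤ (Fin n × Fin n)), Gate.sum args ∈ P.gates →
              ∀ a ∈ args, a.1.natAbs ≤ 2 ^ t) ∧
            (∀ c : ℤ, P.output = .const c → c.natAbs ≤ 2 ^ t)) ∧
          P.size + t + 2 ≤ (Q.size + n + 2) ^ b₁ := by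
  obtain ⟨c₀, hF⟩ := jetFlatness_iff_jet.mp hF
  refine ⟨4 * k₀ + c₀ + Nat.factorial (2 * k₀ + 2) + 2, fun n k hk Q _ _ => ?_⟩
  obtain ⟨P, hP2, hPs, hPc, hPsize⟩ := exists_computes_size_eq_constantFreeComplexity (jet n k)
  refine ⟨P, 0, 1, le_rfl, hP2, by simpa using hPc, heightBound_zero_of_hasSignConstants hPs, ?_⟩
  set X := Q.size + n + 2 with hX
  have hX2 : 2 ≤ X := by omega
  have hnX : n + 2 ≤ X := by omega
  have hfac : Nat.factorial (2 * k + 2) ≤ Nat.factorial (2 * k₀ + 2) :=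
    Nat.factorial_le (by omega)
  have hτ : constantFreeComplexity (jet n k) ≤ X ^ (4 * k₀ + c₀ + Nat.factorial (2 * k₀ + 2)) :=
    calc constantFreeComplexity (jet n k)
        ≤ (n + 2) ^ (4 * k + c₀) * Nat.factorial (2 * k + 2) := hF n k
      _ ≤ X ^ (4 * k + c₀) * X ^ Nat.factorial (2 * k + 2) := by
          apply Nat.mul_le_mul (Nat.pow_le_pow_left hnX _)
          exact le_trans (Nat.lt_two_pow_self).le (Nat.pow_le_pow_left hX2 _)
      _ = X ^ (4 * k + c₀ + Nat.factorial (2 * k + 2)) := (pow_add _ _ _).symm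
      _ ≤ X ^ (4 * k₀ + c₀ + Nat.factorial (2 * k₀ + 2)) :=
          Nat.pow_le_pow_right (by omega) (by omega)
  calc P.size + 0 + 2 = constantFreeComplexity (jet n k) + 2 := by rw [hPsize]
    _ ≤ X ^ (4 * k₀ + c₀ + Nat.factorial (2 * k₀ + 2)) + X := add_le_add hτ hX2
    _ ≤ X ^ (4 * k₀ + c₀ + Nat.factorial (2 * k₀ + 2) + 2) := LacunarySymmetroidMatrixDescartes.StubShadowArith.pow_add_self_le X _ hX2

/-! ### The `Q`-free road is closed: uniform integer circuits for multiples refute `CF` under `MR` -/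

/-- **Uniform bounded-height integer multiples give `IM` for free** (ignoring `Q`): if for some `c`
every jet `J_(n,k)`, `k ≤ log₂ n`, has an integer fan-in-two circuit of height `2^t` computing some
`M·J_(n,k)`, `M ≥ 1`, with `size + t + 2 ≤ (n+2)^c`, then `IM` holds with `b₁ = c`. This is the
only `Q`-insensitive way to the stub. [folklore] -/
theorem integralMultiple_jet_of_uniformIntegralJets
    (hU : ∃ c : ℕ, ∀ n k : ℕ, k ≤ Nat.log 2 n → ∃ (P : ArithCircuit ℤ (Fin n × Fin n)) (t M : ℕ),
        1 ≤ M ∧ P.IsFanInTwo ∧ P.Computes ((M : ℤ) • jet n k) ∧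
        ((∀ g ∈ P.gates, ∀ u ∈ g.args, ∀ c : ℤ, u = .const c → c.natAbs ≤ 2 ^ t) ∧
          (∀ args : List (ℤ × Operand ℤ (Fin n × Fin n)), Gate.sum args ∈ P.gates → ∀ a ∈ args, a.1.natAbs ≤ 2 ^ t) ∧
          (∀ c : ℤ, P.output = .const c → c.natAbs ≤ 2 ^ t)) ∧ P.size + t + 2 ≤ (n + 2) ^ c) :
    ∃ b₁ : ℕ, ∀ n k : ℕ, k ≤ Nat.log 2 n →
      ∀ Q : ArithCircuit (AlgebraicClosure ℚ) (Fin n × Fin n), Q.IsFanInTwo →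
        Q.Computes (MvPolynomial.map (Int.castRingHom (AlgebraicClosure ℚ)) (jet n k)) →
        ∃ (P : ArithCircuit ℤ (Fin n × Fin n)) (t M : ℕ),
          1 ≤ M ∧ P.IsFanInTwo ∧ P.Computes ((M : ℤ) • jet n k) ∧
          ((∀ g ∈ P.gates, ∀ u ∈ g.args, ∀ c : ℤ, u = .const c → c.natAbs ≤ 2 ^ t) ∧
            (∀ args : List (ℤ × Operand ℤ (Fin n × Fin n)), Gate.sum args ∈ P.gates →
              ∀ a ∈ args, a.1.natAbs ≤ 2 ^ t) ∧
            (∀ c : ℤ, P.output = .const c → c.natAbs ≤ 2 ^ t)) ∧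
          P.size + t + 2 ≤ (Q.size + n + 2) ^ b₁ := by
  obtain ⟨c, hc⟩ := hU
  refine ⟨c, fun n k hk Q _ _ => ?_⟩
  obtain ⟨P, t, M, hM, hP2, hPc, hPb, hPs⟩ := hc n k hk
  exact ⟨P, t, M, hM, hP2, hPc, hPb, hPs.trans (Nat.pow_le_pow_left (by omega) _)⟩

/-- **Uniform integer multiples are uniformly cheap multiples** (`stub_signSimulation`, PROVED):
`τ(M·J_(n,k)) ≤ (size + t + 2)^{b₂} ≤ (n+2)^{c b₂}`. [cite: Burgisser2000, §1.4] -/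
theorem cheapMultiples_of_uniformIntegralJets
    (hU : ∃ c : ℕ, ∀ n k : ℕ, k ≤ Nat.log 2 n → ∃ (P : ArithCircuit ℤ (Fin n × Fin n)) (t M : ℕ),
        1 ≤ M ∧ P.IsFanInTwo ∧ P.Computes ((M : ℤ) • jet n k) ∧
        ((∀ g ∈ P.gates, ∀ u ∈ g.args, ∀ c : ℤ, u = .const c → c.natAbs ≤ 2 ^ t) ∧
          (∀ args : List (ℤ × Operand ℤ (Fin n × Fin n)), Gate.sum args ∈ P.gates → ∀ a ∈ args, a.1.natAbs ≤ 2 ^ t) ∧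
          (∀ c : ℤ, P.output = .const c → c.natAbs ≤ 2 ^ t)) ∧ P.size + t + 2 ≤ (n + 2) ^ c) :
    ∃ c : ℕ, ∀ n k : ℕ, k ≤ Nat.log 2 n →
      ∃ M : ℕ, 1 ≤ M ∧ constantFreeComplexity ((M : ℤ) • jet n k) ≤ (n + 2) ^ c := by
  obtain ⟨c, hc⟩ := hU
  obtain ⟨b₂, hb₂⟩ := stub_signSimulation
  refine ⟨c * b₂, fun n k hk => ?_⟩
  obtain ⟨P, t, M, hM, hP2, hPc, hPb, hPs⟩ := hc n k hk
  refine ⟨M, hM, ?_⟩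
  calc constantFreeComplexity ((M : ℤ) • jet n k) ≤ (P.size + t + 2) ^ b₂ :=
        hb₂ (Fin n × Fin n) _ P t hP2 hPc hPb
    _ ≤ ((n + 2) ^ c) ^ b₂ := Nat.pow_le_pow_left hPs _
    _ = (n + 2) ^ (c * b₂) := by rw [← pow_mul]

/-- **The `Q`-free road is closed**: uniform bounded-height integer circuits for multiples of the
jets (the only circuit-insensitive source of `IM`), together with the sibling stub `MR`, REFUTE the
sibling crux `ConstantFreeJetGrowth` (tree: `uniformTau_of_cheapMultiples_of_multiplierRemoval`,
`not_constantFreeJetGrowth_of_uniformTau`). Hence any proof of `IM` the route can use must read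
the near-optimal `ℚ̄`-circuit `Q` it is given. [folklore] -/
theorem not_constantFreeJetGrowth_of_uniformIntegralJets_of_multiplierRemoval
    (hU : ∃ c : ℕ, ∀ n k : ℕ, k ≤ Nat.log 2 n → ∃ (P : ArithCircuit ℤ (Fin n × Fin n)) (t M : ℕ),
        1 ≤ M ∧ P.IsFanInTwo ∧ P.Computes ((M : ℤ) • jet n k) ∧
        ((∀ g ∈ P.gates, ∀ u ∈ g.args, ∀ c : ℤ, u = .const c → c.natAbs ≤ 2 ^ t) ∧
          (∀ args : List (ℤ × Operand ℤ (Fin n × Fin n)), Gate.sum args ∈ P.gates → ∀ a ∈ args, a.1.natAbs ≤ 2 ^ t) ∧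
          (∀ c : ℤ, P.output = .const c → c.natAbs ≤ 2 ^ t)) ∧ P.size + t + 2 ≤ (n + 2) ^ c)
    (hR : ∃ b₃ : ℕ, ∀ n k M : ℕ, k ≤ Nat.log 2 n → 1 ≤ M →
      constantFreeComplexity (jet n k) ≤ (constantFreeComplexity ((M : ℤ) • jet n k) + n + 2) ^ b₃) :
    ¬ ConstantFreeJetGrowth :=
  not_constantFreeJetGrowth_of_uniformTau
    (uniformTau_of_cheapMultiples_of_multiplierRemoval (cheapMultiples_of_uniformIntegralJets hU) hR)

end Summit.ValiantsHypothesis.ValiantsHypothesis.Theorems.AnyonJets.JetConstantElim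

end
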